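import Mathlib
import Summits.Ventures.PercRepro2.Defs
import Summits.Ventures.PercRepro2.Graph
import Summits.Ventures.PercRepro2.HullDefs
import Summits.Ventures.PercRepro2.HullPieceFlip
import Summits.Ventures.PercRepro2.SwSide
import Summits.Ventures.PercRepro2.RigidLemma
import Summits.Ventures.PercRepro2.RigidSide

/-!
# The typed rigid side injection (blind cell PercRepro2, night-4 g6, 2026-08-24;
proofs/NIGHT4-G6.md §12)

The rigid side injection (RS) of RigidSide.lean in its TYPED form: for an UP-SET `𝓤` and a DOWN-SET
`𝓓` of vertex sets, an injection of `{C_R(l) ∈ 𝓤, C_B(l) ∈ 𝓓, c ∈ B_side(l)}` into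
`{C_R(l) ∈ 𝓤, C_B(l) ∈ 𝓓, c ∈ R_side(l)}` turning every red edge inside `C_R(c)` blue
(`exists_typedRigidSide`; (RS) is `𝓤 = {S ∣ o ∈ S}`, `𝓓 = {S ∣ o ∉ S}`).  The proof is the proof of
(RS): the colour swap, the datum classes of `C_B(c)`, and on a class with `l ∉ C_B(c)` Harris (mixed)
on the decreasing `{C_B(l) ∈ 𝓤, C_R(l) ∈ 𝓓}` against the increasing `{c ∈ C_R(l)}`, the colour swap
OFF the edges touching `C_B(c)` — which maps `{C_B(l) ∈ 𝓤, C_R(l) ∈ 𝓓}` into `{C_R(l) ∈ 𝓤, C_B(l) ∈ 𝓓}`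
because a blue path from `l ∉ S` never touches `S` and turns red (`conn_swapOff_of_conn_blue`), and
conversely a blue path of the swapped colouring from `l` is a red path of the original
(`conn_of_conn_blue_swapOff`) — and Harris (upper) on the increasing `{C_R(l) ∈ 𝓤, C_B(l) ∈ 𝓓}`
and `{c ∈ C_R(l)}`; no cancellation of the core is needed since `c ∉ C_B(l)` on such a class.
This is the side ingredient of the cut-vertex composition of the TYPED rigid row (INBOX hourly #6).
-/

namespace Summit.Ventures.PercRepro2

namespace TypedRS

open Hull SwSide RigidSide

open scoped Classical

variable {V : Type*} {E : Type*} [Fintype E] [DecidableEq E]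

/-! ## The typed events -/

section Events

variable {ends : E → Sym2 V}

/-- `{C_R(l) ∈ 𝓤}`. -/
def redIn𝓤 (ends : E → Sym2 V) (l : V) (𝓤 : Set (Set V)) : Set (Config E) :=
  {ζ | cluster ends ζ l ∈ 𝓤}

/-- `{C_B(l) ∈ 𝓤}`. -/
def blueIn𝓤 (ends : E → Sym2 V) (l : V) (𝓤 : Set (Set V)) : Set (Config E) :=
  {ζ | cluster ends (blue ζ) l ∈ 𝓤}

/-- The decreasing class `{C_B(l) ∈ 𝓤, C_R(l) ∈ 𝓓}`. -/
def lowerT (ends : E → Sym2 V) (l : V) (𝓤 𝓓 : Set (Set V)) : Set (Config E) :=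
  {ζ | cluster ends (blue ζ) l ∈ 𝓤 ∧ cluster ends ζ l ∈ 𝓓}

/-- The increasing class `{C_R(l) ∈ 𝓤, C_B(l) ∈ 𝓓}`. -/
def upperT (ends : E → Sym2 V) (l : V) (𝓤 𝓓 : Set (Set V)) : Set (Config E) :=
  {ζ | cluster ends ζ l ∈ 𝓤 ∧ cluster ends (blue ζ) l ∈ 𝓓}

omit [Fintype E] [DecidableEq E] in
/-- `{C_R(l) ∈ 𝓤}` is increasing for an up-set `𝓤`. -/
lemma isUpperSet_redIn𝓤 (l : V) {𝓤 : Set (Set V)} (h𝓤 : IsUpperSet 𝓤) :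
    IsUpperSet (redIn𝓤 ends l 𝓤) :=
  fun _ _ hle hζ => h𝓤 (cluster_mono hle l) hζ

omit [Fintype E] [DecidableEq E] in
/-- `{C_R(l) ∈ 𝓓}` is decreasing for a down-set `𝓓`. -/
lemma isLowerSet_redIn𝓓 (l : V) {𝓓 : Set (Set V)} (h𝓓 : IsLowerSet 𝓓) :
    IsLowerSet (redIn𝓤 ends l 𝓓) :=
  fun _ _ hle hζ => h𝓓 (cluster_mono hle l) hζ

omit [Fintype E] [DecidableEq E] in
/-- `{C_B(l) ∈ 𝓤}` is decreasing for an up-set `𝓤`. -/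
lemma isLowerSet_blueIn𝓤 (l : V) {𝓤 : Set (Set V)} (h𝓤 : IsUpperSet 𝓤) :
    IsLowerSet (blueIn𝓤 ends l 𝓤) :=
  fun _ _ hle hζ => h𝓤 (cluster_mono (Rigid.blue_antitone hle) l) hζ

omit [Fintype E] [DecidableEq E] in
/-- `{C_B(l) ∈ 𝓓}` is increasing for a down-set `𝓓`. -/
lemma isUpperSet_blueIn𝓓 (l : V) {𝓓 : Set (Set V)} (h𝓓 : IsLowerSet 𝓓) :
    IsUpperSet (blueIn𝓤 ends l 𝓓) :=
  fun _ _ hle hζ => h𝓓 (cluster_mono (Rigid.blue_antitone hle) l) hζ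

omit [Fintype E] [DecidableEq E] in
/-- `lowerT` is decreasing. -/
lemma isLowerSet_lowerT (l : V) {𝓤 𝓓 : Set (Set V)} (h𝓤 : IsUpperSet 𝓤) (h𝓓 : IsLowerSet 𝓓) :
    IsLowerSet (lowerT ends l 𝓤 𝓓) :=
  fun _ _ hle hζ => ⟨h𝓤 (cluster_mono (Rigid.blue_antitone hle) l) hζ.1, h𝓓 (cluster_mono hle l) hζ.2⟩

omit [Fintype E] [DecidableEq E] in
/-- `upperT` is increasing. -/
lemma isUpperSet_upperT (l : V) {𝓤 𝓓 : Set (Set V)} (h𝓤 : IsUpperSet 𝓤) (h𝓓 : IsLowerSet 𝓓) :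
    IsUpperSet (upperT ends l 𝓤 𝓓) :=
  fun _ _ hle hζ => ⟨h𝓤 (cluster_mono hle l) hζ.1, h𝓓 (cluster_mono (Rigid.blue_antitone hle) l) hζ.2⟩

omit [Fintype E] [DecidableEq E] in
/-- **A blue path of the swapped colouring from `l ∉ C_B(c)` is a red path of the original.** -/
lemma conn_of_conn_blue_swapOff {c l o : V} {ζ : Config E} {S : Set V}
    (hS : cluster ends (blue ζ) c = S) (hl : l ∉ S)
    (hc : Conn ends (blue (swapOff ends S ζ)) l o) : Conn ends ζ l o := by
  subst hS
  -- the blue cluster of `c` in the swapped colouring is the same set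
  have hS' : cluster ends (blue (swapOff ends (cluster ends (blue ζ) c) ζ)) c =
      cluster ends (blue ζ) c :=
    cluster_eq_of_eqOn_touches (ω := blue ζ)
      (ω' := blue (swapOff ends (cluster ends (blue ζ) c) ζ))
      (fun e he => by simp only [blue_apply, swapOff_of_mem he]) rfl
  refine conn_of_eqOn_off_touches (l := c) (P := cluster ends (blue ζ) c) (hS'.symm ▸ le_refl _)
    (by rw [hS']; exact hl) (fun e he => ?_) hc
  simp only [blue_apply, swapOff_of_notMem he, Bool.not_not]

end Events

/-! ## The class inequality -/

section Class

variable {ends : E → Sym2 V}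

/-- **The swap injection on a class, typed**: on the cylinder of a datum of `c` with `l ∉ S`,
`#{C_B(l) ∈ 𝓤, C_R(l) ∈ 𝓓} ≤ #{C_R(l) ∈ 𝓤, C_B(l) ∈ 𝓓}` for an up-set `𝓤` and a down-set `𝓓`. -/
theorem cnt_typed_le {c l : V} (ζ₀ : Config E) (hl : l ∉ cluster ends (blue ζ₀) c)
    {𝓤 𝓓 : Set (Set V)} (h𝓤 : IsUpperSet 𝓤) (h𝓓 : IsLowerSet 𝓓) :
    cnt ζ₀ (touchF ends c ζ₀) (lowerT ends l 𝓤 𝓓) ≤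
      cnt ζ₀ (touchF ends c ζ₀) (upperT ends l 𝓤 𝓓) := by
  unfold cnt
  refine Finset.card_le_card_of_injOn (swapOff ends (cluster ends (blue ζ₀) c)) ?_ ?_
  · intro ζ hζ
    rw [Finset.mem_coe, Finset.mem_filter, mem_fib_touchF] at hζ
    rw [Finset.mem_coe, Finset.mem_filter, mem_fib_touchF]
    obtain ⟨hag, hmem⟩ := hζ
    obtain ⟨h1, h2⟩ : cluster ends (blue ζ) l ∈ 𝓤 ∧ cluster ends ζ l ∈ 𝓓 := hmem
    have hS := cluster_blue_eq_of_agree hag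
    refine ⟨fun e he => by rw [swapOff_of_mem he]; exact hag e he, ?_⟩
    show cluster ends (swapOff ends (cluster ends (blue ζ₀) c) ζ) l ∈ 𝓤 ∧
      cluster ends (blue (swapOff ends (cluster ends (blue ζ₀) c) ζ)) l ∈ 𝓓
    refine ⟨?_, ?_⟩
    · -- `C_B(l)(ζ) ⊆ C_R(l)(swapOff ζ)`, so the up-set membership passes
      refine h𝓤 ?_ h1
      intro u hu
      exact conn_swapOff_of_conn_blue hS hl hu
    · -- `C_B(l)(swapOff ζ) ⊆ C_R(l)(ζ)`, so the down-set membership passes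
      refine h𝓓 ?_ h2
      intro u hu
      exact conn_of_conn_blue_swapOff hS hl hu
  · intro ζ₁ _ ζ₂ _ h12
    have := congrArg (swapOff ends (cluster ends (blue ζ₀) c)) h12
    simpa only [swapOff_swapOff] using this

/-- **The typed class inequality**: on the cylinder of a datum of `c` with `l ∉ S`,
`#{C_B(l) ∈ 𝓤, C_R(l) ∈ 𝓓, c ∈ C_R(l)} ≤ #{C_R(l) ∈ 𝓤, C_B(l) ∈ 𝓓, c ∈ C_R(l)}`. -/
theorem cnt_typed_class_le {c l : V} (ζ₀ : Config E) (hl : l ∉ cluster ends (blue ζ₀) c)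
    {𝓤 𝓓 : Set (Set V)} (h𝓤 : IsUpperSet 𝓤) (h𝓓 : IsLowerSet 𝓓) :
    cnt ζ₀ (touchF ends c ζ₀) (lowerT ends l 𝓤 𝓓 ∩ connEvent ends l c) ≤
      cnt ζ₀ (touchF ends c ζ₀) (upperT ends l 𝓤 𝓓 ∩ connEvent ends l c) := by
  set F := touchF ends c ζ₀
  have h1 := cnt_le_cnt_mul_cnt_of_lower ζ₀ F (isLowerSet_lowerT (ends := ends) l h𝓤 h𝓓)
    (isUpperSet_connEvent ends l c)
  have h2 := cnt_typed_le (ends := ends) ζ₀ hl h𝓤 h𝓓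
  have h3 := cnt_mul_cnt_le_of_upper ζ₀ F (isUpperSet_upperT (ends := ends) l h𝓤 h𝓓)
    (isUpperSet_connEvent ends l c)
  have hpos : 0 < 2 ^ Fᶜ.card := by positivity
  refine Nat.le_of_mul_le_mul_right ?_ hpos
  calc cnt ζ₀ F (lowerT ends l 𝓤 𝓓 ∩ connEvent ends l c) * 2 ^ Fᶜ.card
      ≤ cnt ζ₀ F (lowerT ends l 𝓤 𝓓) * cnt ζ₀ F (connEvent ends l c) := h1
    _ ≤ cnt ζ₀ F (upperT ends l 𝓤 𝓓) * cnt ζ₀ F (connEvent ends l c) := Nat.mul_le_mul_right _ h2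
    _ ≤ cnt ζ₀ F (upperT ends l 𝓤 𝓓 ∩ connEvent ends l c) * 2 ^ Fᶜ.card := h3

end Class

/-! ## Summing over the classes -/

section Sum

variable {ends : E → Sym2 V}

/-- **The typed one-sided inequality for a predicate on the datum of `c`**:
`#{C_B(l) ∈ 𝓤, C_R(l) ∈ 𝓓, c ∈ R_side(l), P(datum)} ≤ #{C_R(l) ∈ 𝓤, C_B(l) ∈ 𝓓, c ∈ R_side(l), P(datum)}`. -/
theorem card_typed_le_datum (l c : V) {𝓤 𝓓 : Set (Set V)} (h𝓤 : IsUpperSet 𝓤) (h𝓓 : IsLowerSet 𝓓)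
    (P : Config E → Prop) :
    (Finset.univ.filter fun ζ : Config E =>
        cluster ends (blue ζ) l ∈ 𝓤 ∧ cluster ends ζ l ∈ 𝓓 ∧ c ∈ rside ends ζ l ∧
          P (datum ends c ζ)).card ≤
      (Finset.univ.filter fun ζ : Config E =>
        cluster ends ζ l ∈ 𝓤 ∧ cluster ends (blue ζ) l ∈ 𝓓 ∧ c ∈ rside ends ζ l ∧
          P (datum ends c ζ)).card := by
  rw [Finset.card_eq_sum_card_fiberwise (f := datum ends c) (t := (Finset.univ : Finset (Config E)))
      (fun _ _ => Finset.mem_univ _),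
    Finset.card_eq_sum_card_fiberwise (f := datum ends c) (t := (Finset.univ : Finset (Config E)))
      (fun _ _ => Finset.mem_univ _)]
  refine Finset.sum_le_sum fun d _ => ?_
  by_cases hne : ((Finset.univ.filter fun ζ : Config E =>
      cluster ends (blue ζ) l ∈ 𝓤 ∧ cluster ends ζ l ∈ 𝓓 ∧ c ∈ rside ends ζ l ∧
        P (datum ends c ζ)).filter fun ζ => datum ends c ζ = d) = ∅
  · rw [hne, Finset.card_empty]; exact Nat.zero_le _
  obtain ⟨ζ₀, hζ₀⟩ := Finset.nonempty_iff_ne_empty.2 hne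
  rw [Finset.mem_filter, Finset.mem_filter] at hζ₀
  obtain ⟨⟨_, _, _, hcR, hP⟩, hd⟩ := hζ₀
  have hcB : c ∉ cluster ends (blue ζ₀) l := hcR.2
  have hl : l ∉ cluster ends (blue ζ₀) c := by
    simp only [mem_cluster] at hcB ⊢
    exact fun hc => hcB (conn_symm hc)
  -- on the class `c ∉ C_B(l)` is automatic: `c ∈ R_side(l) ↔ c ∈ C_R(l)`
  have e1 : ((Finset.univ.filter fun ζ : Config E =>
      cluster ends (blue ζ) l ∈ 𝓤 ∧ cluster ends ζ l ∈ 𝓓 ∧ c ∈ rside ends ζ l ∧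
        P (datum ends c ζ)).filter fun ζ => datum ends c ζ = d).card =
      cnt ζ₀ (touchF ends c ζ₀) (lowerT ends l 𝓤 𝓓 ∩ connEvent ends l c) := by
    unfold cnt
    congr 1
    ext ζ
    simp only [Finset.mem_filter, Finset.mem_univ, true_and, mem_fib_touchF, ← hd, datum_eq_iff,
      Set.mem_inter_iff, lowerT, connEvent, Set.mem_setOf_eq, mem_rside_iff, mem_cluster]
    constructor
    · rintro ⟨⟨h1, h2, ⟨h3, _⟩, _⟩, hag⟩
      exact ⟨hag, ⟨h1, h2⟩, h3⟩
    · rintro ⟨hag, ⟨h1, h2⟩, h3⟩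
      refine ⟨⟨h1, h2, ⟨h3, ?_⟩, ?_⟩, hag⟩
      · rw [conn_blue_lh_iff_of_agree hag]; simpa only [mem_cluster] using hcB
      · rw [datum_eq_iff.2 hag]; exact hP
  have e2 : ((Finset.univ.filter fun ζ : Config E =>
      cluster ends ζ l ∈ 𝓤 ∧ cluster ends (blue ζ) l ∈ 𝓓 ∧ c ∈ rside ends ζ l ∧
        P (datum ends c ζ)).filter fun ζ => datum ends c ζ = d).card =
      cnt ζ₀ (touchF ends c ζ₀) (upperT ends l 𝓤 𝓓 ∩ connEvent ends l c) := by
    unfold cnt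
    congr 1
    ext ζ
    simp only [Finset.mem_filter, Finset.mem_univ, true_and, mem_fib_touchF, ← hd, datum_eq_iff,
      Set.mem_inter_iff, upperT, connEvent, Set.mem_setOf_eq, mem_rside_iff, mem_cluster]
    constructor
    · rintro ⟨⟨h1, h2, ⟨h3, _⟩, _⟩, hag⟩
      exact ⟨hag, ⟨h1, h2⟩, h3⟩
    · rintro ⟨hag, ⟨h1, h2⟩, h3⟩
      refine ⟨⟨h1, h2, ⟨h3, ?_⟩, ?_⟩, hag⟩
      · rw [conn_blue_lh_iff_of_agree hag]; simpa only [mem_cluster] using hcB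
      · rw [datum_eq_iff.2 hag]; exact hP
  rw [e1, e2]
  exact cnt_typed_class_le (ends := ends) ζ₀ hl h𝓤 h𝓓

/-- **The Hall inequality of the typed (RS)**: for an up-set `𝓤`, a down-set `𝓓` and an up-set `𝓕`
of edge sets, `#{C_R(l) ∈ 𝓤, C_B(l) ∈ 𝓓, c ∈ B_side, red_in(C_R(c)) ∈ 𝓕} ≤
#{C_R(l) ∈ 𝓤, C_B(l) ∈ 𝓓, c ∈ R_side, blue ∈ 𝓕}`. -/
theorem card_typedRigidSide_le (l c : V) {𝓤 𝓓 : Set (Set V)} (h𝓤 : IsUpperSet 𝓤)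
    (h𝓓 : IsLowerSet 𝓓) (𝓕 : Set (Finset E)) (h𝓕 : IsUpperSet 𝓕) :
    (Finset.univ.filter fun ζ : Config E =>
        cluster ends ζ l ∈ 𝓤 ∧ cluster ends (blue ζ) l ∈ 𝓓 ∧ c ∈ bside ends ζ l ∧
          redIn ends c ζ ∈ 𝓕).card ≤
      (Finset.univ.filter fun ζ : Config E =>
        cluster ends ζ l ∈ 𝓤 ∧ cluster ends (blue ζ) l ∈ 𝓓 ∧ c ∈ rside ends ζ l ∧
          RigidSide.blueF ζ ∈ 𝓕).card := by
  -- step 1: the colour swap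
  have step1 : (Finset.univ.filter fun ζ : Config E =>
        cluster ends ζ l ∈ 𝓤 ∧ cluster ends (blue ζ) l ∈ 𝓓 ∧ c ∈ bside ends ζ l ∧
          redIn ends c ζ ∈ 𝓕).card ≤
      (Finset.univ.filter fun ζ : Config E =>
        cluster ends (blue ζ) l ∈ 𝓤 ∧ cluster ends ζ l ∈ 𝓓 ∧ c ∈ rside ends ζ l ∧
          blueIn ends c ζ ∈ 𝓕).card := by
    refine Finset.card_le_card_of_injOn blue ?_ ?_
    · intro ζ hζ
      rw [Finset.mem_coe, Finset.mem_filter] at hζ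
      rw [Finset.mem_coe, Finset.mem_filter, blue_blue, rside_blue, blueIn_blue]
      exact ⟨Finset.mem_univ _, hζ.2⟩
    · intro ζ₁ _ ζ₂ _ h12
      have := congrArg blue h12
      simpa only [blue_blue] using this
  -- step 2: the typed one-sided inequality for the datum predicate `blue_in(C_B(c)) ∈ 𝓕`
  have step2 : (Finset.univ.filter fun ζ : Config E =>
        cluster ends (blue ζ) l ∈ 𝓤 ∧ cluster ends ζ l ∈ 𝓓 ∧ c ∈ rside ends ζ l ∧
          blueIn ends c ζ ∈ 𝓕).card ≤
      (Finset.univ.filter fun ζ : Config E =>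
        cluster ends ζ l ∈ 𝓤 ∧ cluster ends (blue ζ) l ∈ 𝓓 ∧ c ∈ rside ends ζ l ∧
          blueIn ends c ζ ∈ 𝓕).card := by
    have key := card_typed_le_datum (ends := ends) l c h𝓤 h𝓓 (fun d => blueIn ends c d ∈ 𝓕)
    simpa only [blueIn_datum] using key
  -- step 3: `blue_in(C_B(c)) ⊆ blue`
  have step3 : (Finset.univ.filter fun ζ : Config E =>
        cluster ends ζ l ∈ 𝓤 ∧ cluster ends (blue ζ) l ∈ 𝓓 ∧ c ∈ rside ends ζ l ∧
          blueIn ends c ζ ∈ 𝓕).card ≤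
      (Finset.univ.filter fun ζ : Config E =>
        cluster ends ζ l ∈ 𝓤 ∧ cluster ends (blue ζ) l ∈ 𝓓 ∧ c ∈ rside ends ζ l ∧
          RigidSide.blueF ζ ∈ 𝓕).card := by
    apply Finset.card_le_card
    intro ζ hζ
    rw [Finset.mem_filter] at hζ ⊢
    refine ⟨hζ.1, hζ.2.1, hζ.2.2.1, hζ.2.2.2.1, h𝓕 ?_ hζ.2.2.2.2⟩
    intro e he
    rw [mem_blueIn] at he
    rw [RigidSide.mem_blueF]; exact he.2
  exact step1.trans (step2.trans step3)

/-- The typed source: `{C_R(l) ∈ 𝓤, C_B(l) ∈ 𝓓, c ∈ B_side(l)}`. -/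
noncomputable def srcT (ends : E → Sym2 V) (l c : V) (𝓤 𝓓 : Set (Set V)) : Finset (Config E) :=
  Finset.univ.filter fun ζ =>
    cluster ends ζ l ∈ 𝓤 ∧ cluster ends (blue ζ) l ∈ 𝓓 ∧ c ∈ bside ends ζ l

/-- The typed target: `{C_R(l) ∈ 𝓤, C_B(l) ∈ 𝓓, c ∈ R_side(l)}`. -/
noncomputable def tgtT (ends : E → Sym2 V) (l c : V) (𝓤 𝓓 : Set (Set V)) : Finset (Config E) :=
  Finset.univ.filter fun ζ =>
    cluster ends ζ l ∈ 𝓤 ∧ cluster ends (blue ζ) l ∈ 𝓓 ∧ c ∈ rside ends ζ l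

/-- **The typed rigid side injection** (Hall): for an up-set `𝓤` and a down-set `𝓓` of vertex sets,
an injection `{C_R(l) ∈ 𝓤, C_B(l) ∈ 𝓓, c ∈ B_side} → {C_R(l) ∈ 𝓤, C_B(l) ∈ 𝓓, c ∈ R_side}` under
which every red edge inside the red cluster of `c` of the source is blue in the image. -/
theorem exists_typedRigidSide (l c : V) {𝓤 𝓓 : Set (Set V)} (h𝓤 : IsUpperSet 𝓤)
    (h𝓓 : IsLowerSet 𝓓) :
    ∃ f : {ζ // ζ ∈ srcT ends l c 𝓤 𝓓} → Config E, Function.Injective f ∧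
      ∀ x, f x ∈ tgtT ends l c 𝓤 𝓓 ∧
        ∀ e, e ∈ within ends (cluster ends x.1 c) → x.1 e = true → f x e = false := by
  let t : {ζ // ζ ∈ srcT ends l c 𝓤 𝓓} → Finset (Config E) := fun x =>
    (tgtT ends l c 𝓤 𝓓).filter fun η => ∀ e ∈ redIn ends c x.1, η e = false
  have hall : ∀ s : Finset {ζ // ζ ∈ srcT ends l c 𝓤 𝓓}, s.card ≤ (s.biUnion t).card := by
    intro s
    obtain ⟨𝓕, h𝓕, h𝓕mem⟩ : ∃ 𝓕 : Set (Finset E), IsUpperSet 𝓕 ∧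
        ∀ F, F ∈ 𝓕 ↔ ∃ x ∈ s, redIn ends c x.1 ⊆ F :=
      ⟨{F | ∃ x ∈ s, redIn ends c x.1 ⊆ F}, fun F F' hFF' ⟨x, hx, hxF⟩ => ⟨x, hx, hxF.trans hFF'⟩,
        fun F => Iff.rfl⟩
    have e1 : s.biUnion t = Finset.univ.filter fun ζ : Config E =>
        cluster ends ζ l ∈ 𝓤 ∧ cluster ends (blue ζ) l ∈ 𝓓 ∧ c ∈ rside ends ζ l ∧
          RigidSide.blueF ζ ∈ 𝓕 := by
      ext η
      simp only [Finset.mem_biUnion, Finset.mem_filter, t, tgtT, Finset.mem_univ, true_and, h𝓕mem]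
      constructor
      · rintro ⟨x, hx, ⟨h1, h2, h3⟩, hsub⟩
        exact ⟨h1, h2, h3, x, hx, fun e he => RigidSide.mem_blueF.2 (hsub e he)⟩
      · rintro ⟨h1, h2, h3, x, hx, hsub⟩
        exact ⟨x, hx, ⟨h1, h2, h3⟩, fun e he => RigidSide.mem_blueF.1 (hsub he)⟩
    have e2 : s.card ≤ (Finset.univ.filter fun ζ : Config E =>
        cluster ends ζ l ∈ 𝓤 ∧ cluster ends (blue ζ) l ∈ 𝓓 ∧ c ∈ bside ends ζ l ∧
          redIn ends c ζ ∈ 𝓕).card := by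
      refine Finset.card_le_card_of_injOn (fun x => x.1) ?_ ?_
      · intro x hx
        rw [Finset.mem_coe] at hx
        have hx1 := x.2
        simp only [srcT, Finset.mem_filter, Finset.mem_univ, true_and] at hx1
        simp only [Finset.mem_coe, Finset.mem_filter, Finset.mem_univ, true_and, h𝓕mem]
        exact ⟨hx1.1, hx1.2.1, hx1.2.2, x, hx, subset_rfl⟩
      · intro x _ y _ hxy
        exact Subtype.ext hxy
    rw [e1]
    exact e2.trans (card_typedRigidSide_le (ends := ends) l c h𝓤 h𝓓 𝓕 h𝓕)
  obtain ⟨f, hf, hft⟩ := (Finset.all_card_le_biUnion_card_iff_exists_injective t).1 hall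
  refine ⟨f, hf, fun x => ?_⟩
  have := hft x
  simp only [t, Finset.mem_filter] at this
  exact ⟨this.1, fun e he hred => this.2 e ((mem_redIn ends).2 ⟨he, hred⟩)⟩

end Sum

end TypedRS

end Summit.Ventures.PercRepro2
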